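import Mathlib.Analysis.ODE.ExistUnique
import Mathlib.Topology.Order.IntermediateValue
import Literature.Analysis.FluidPDE.CompressibleEulerImplosionMonatomicAlgebra
import HarnessLib

/-!
# Buckmaster–Cao-Labora–Gómez-Serrano at `γ = 5/3`: the invariant diagonal `W = Z`

Topic `Literature/Analysis/FluidPDE`; namespace
`Literature.Analysis.FluidPDE.BuckmasterCaolaboraGomezserrano2025.Monatomic`. Companion of
`CompressibleEulerImplosion.lean` (named fact `BuckmasterCaolaboraGomezserrano2025_thm11_monatomic`,
THEOREM 1.1 of T. Buckmaster, G. Cao-Labora, J. Gómez-Serrano, *Smooth imploding solutions for 3D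
compressible fluids*, Forum Math. Pi 13 (2025) e6, arXiv:2208.09445, at `γ = 5/3`, `α = 1/3`)
and of `CompressibleEulerImplosionMonatomicAlgebra.lean` (Brick B: the autonomous system (1.8) at
`α = 1/3`, `DW`, `DZ`, `NW`, `NZ`). Brick A-lite of the discharge plan, the part of the planar
dynamics used in the proof of Prop. 3.1 that needs no Poincaré–Bendixson theory: "It can not exit
through the line `W = Z` because that line is an invariant of the field (`N_W/D_W, N_Z/D_Z` is
proportional to `(1, 1)` in that diagonal)" — and, consequently, the sign of `W − Z` (the density,
"the region `W − Z > 0` for which the density is positive", §1.3) is preserved along every solution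
of (1.8) on an interval on which `D_W D_Z ≠ 0`.

Mechanism (all PROVED, theorems + one real definition): `N_W D_Z − N_Z D_W = (W − Z)·J(W,Z)`
(`NW_DZ_sub_NZ_DW`), so `δ = W − Z` solves the scalar linear equation `δ′ = h(ξ) δ` with
`h = J/(D_W D_Z)` continuous along the solution; Grönwall uniqueness
(`ODE_solution_unique_of_mem_Ioo`) gives `δ ≡ 0` if `δ` vanishes once (`sub_eq_zero_of_exists`),
and the intermediate value theorem gives sign preservation (`sub_pos_of_exists`).
[cite: BuckmasterCaolaboraGomezserrano2025, §1.3, proof of Prop. 3.1]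
-/

noncomputable section

open Set Filter Topology

namespace Literature.Analysis.FluidPDE

namespace BuckmasterCaolaboraGomezserrano2025

namespace Monatomic

/-- The cofactor `J(W,Z) = −(r + W + Z) D_Z − N_Z/3` of `W − Z` in `N_W D_Z − N_Z D_W`. [folklore] -/
def diagFactor (r W Z : ℝ) : ℝ := -(r + W + Z) * DZ W Z - NZ r W Z / 3

/-- `N_W D_Z − N_Z D_W = (W − Z)·J(W,Z)`: the cross product of the field `(N_W/D_W, N_Z/D_Z)` with
`(1,1)` vanishes on the diagonal. [cite: BuckmasterCaolaboraGomezserrano2025, proof of Prop. 3.1] -/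
theorem NW_DZ_sub_NZ_DW (r W Z : ℝ) :
    NW r W Z * DZ W Z - NZ r W Z * DW W Z = (W - Z) * diagFactor r W Z := by
  unfold diagFactor NW NZ DW DZ; ring

/-- On the diagonal the field is parallel to `(1,1)`: `N_W/D_W = N_Z/D_Z` at `W = Z`.
[cite: BuckmasterCaolaboraGomezserrano2025, proof of Prop. 3.1] -/
theorem field_diag (r W : ℝ) : NW r W W / DW W W = NZ r W W / DZ W W := by
  have h1 : NW r W W = NZ r W W := by unfold NW NZ; ring
  have h2 : DW W W = DZ W W := by unfold DW DZ; ring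
  rw [h1, h2]

/-- [folklore] -/
theorem continuous_diagFactor (r : ℝ) : Continuous fun p : ℝ × ℝ => diagFactor r p.1 p.2 := by
  unfold diagFactor DZ NZ; fun_prop

/-- The derivative of `δ = W − Z` along a solution of (1.8): `δ′ = h·δ` with
`h = J/(D_W D_Z)`. [cite: BuckmasterCaolaboraGomezserrano2025, proof of Prop. 3.1] -/
theorem hasDerivAt_sub_of_field {r : ℝ} {W Z : ℝ → ℝ} {W' Z' ξ : ℝ}
    (hW : HasDerivAt W W' ξ) (hZ : HasDerivAt Z Z' ξ)
    (hDW : DW (W ξ) (Z ξ) ≠ 0) (hDZ : DZ (W ξ) (Z ξ) ≠ 0)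
    (hWeq : DW (W ξ) (Z ξ) * W' = NW r (W ξ) (Z ξ))
    (hZeq : DZ (W ξ) (Z ξ) * Z' = NZ r (W ξ) (Z ξ)) :
    HasDerivAt (fun x => W x - Z x)
      (diagFactor r (W ξ) (Z ξ) / (DW (W ξ) (Z ξ) * DZ (W ξ) (Z ξ)) * (W ξ - Z ξ)) ξ := by
  refine (hW.sub hZ).congr_deriv ?_
  have hJ := NW_DZ_sub_NZ_DW r (W ξ) (Z ξ)
  field_simp
  linear_combination DZ (W ξ) (Z ξ) * hWeq - DW (W ξ) (Z ξ) * hZeq + hJ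

/-- **The diagonal is invariant.** Let `(W, Z)` solve the autonomous system (1.8) (`α = 1/3`,
in the form `D_W W′ = N_W`, `D_Z Z′ = N_Z`) on an open interval `S` on which `D_W D_Z ≠ 0`
along the solution. If `W = Z` at one point of `S` then `W = Z` on all of `S`.
[cite: BuckmasterCaolaboraGomezserrano2025, proof of Prop. 3.1] -/
theorem sub_eq_zero_of_exists {r : ℝ} {W Z W' Z' : ℝ → ℝ} {S : Set ℝ} (hS : IsOpen S)
    (hS' : S.OrdConnected)
    (hW : ∀ ξ ∈ S, HasDerivAt W (W' ξ) ξ) (hZ : ∀ ξ ∈ S, HasDerivAt Z (Z' ξ) ξ)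
    (hDW : ∀ ξ ∈ S, DW (W ξ) (Z ξ) ≠ 0) (hDZ : ∀ ξ ∈ S, DZ (W ξ) (Z ξ) ≠ 0)
    (hWeq : ∀ ξ ∈ S, DW (W ξ) (Z ξ) * W' ξ = NW r (W ξ) (Z ξ))
    (hZeq : ∀ ξ ∈ S, DZ (W ξ) (Z ξ) * Z' ξ = NZ r (W ξ) (Z ξ))
    {ξ₀ : ℝ} (h₀ : ξ₀ ∈ S) (heq : W ξ₀ = Z ξ₀) :
    ∀ ξ ∈ S, W ξ = Z ξ := by
  intro ξ₁ h₁
  -- the coefficient `h` of the linear equation for `δ = W - Z`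
  set h : ℝ → ℝ := fun x => diagFactor r (W x) (Z x) / (DW (W x) (Z x) * DZ (W x) (Z x)) with hh
  have hδ : ∀ x ∈ S, HasDerivAt (fun x => W x - Z x) (h x * (W x - Z x)) x := fun x hx =>
    hasDerivAt_sub_of_field (hW x hx) (hZ x hx) (hDW x hx) (hDZ x hx) (hWeq x hx) (hZeq x hx)
  -- continuity of `h` on `S`
  have hWc : ContinuousOn W S := fun x hx => (hW x hx).continuousAt.continuousWithinAt
  have hZc : ContinuousOn Z S := fun x hx => (hZ x hx).continuousAt.continuousWithinAt
  have hhc : ContinuousOn h S := by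
    have h1 : ContinuousOn (fun x => diagFactor r (W x) (Z x)) S :=
      (continuous_diagFactor r).comp_continuousOn (hWc.prodMk hZc)
    have h2 : ContinuousOn (fun x => DW (W x) (Z x) * DZ (W x) (Z x)) S := by
      unfold DW DZ
      exact ((continuousOn_const.add (((continuousOn_const.mul hWc).add hZc).div_const _)).mul
        (continuousOn_const.add ((hWc.add (continuousOn_const.mul hZc)).div_const _)))
    exact h1.div h2 fun x hx => mul_ne_zero (hDW x hx) (hDZ x hx)
  -- an open interval `(a, b) ⊆ S` containing `ξ₀` and `ξ₁`, with `h` bounded on it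
  set m := min ξ₀ ξ₁ with hm
  set M := max ξ₀ ξ₁ with hM
  have hmS : m ∈ S := by rw [hm]; rcases min_choice ξ₀ ξ₁ with h | h <;> rw [h] <;> assumption
  have hMS : M ∈ S := by rw [hM]; rcases max_choice ξ₀ ξ₁ with h | h <;> rw [h] <;> assumption
  obtain ⟨ε₁, hε₁, hε₁S⟩ := Metric.isOpen_iff.mp hS m hmS
  obtain ⟨ε₂, hε₂, hε₂S⟩ := Metric.isOpen_iff.mp hS M hMS
  set a := m - ε₁ / 2 with ha
  set b := M + ε₂ / 2 with hb
  have haS : a ∈ S := hε₁S (by rw [Metric.mem_ball, Real.dist_eq, ha]; rw [abs_of_neg (by linarith)]; linarith)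
  have hbS : b ∈ S := hε₂S (by rw [Metric.mem_ball, Real.dist_eq, hb]; rw [abs_of_pos (by linarith)]; linarith)
  have hIcc : Icc a b ⊆ S := hS'.out haS hbS
  have hIoo : Ioo a b ⊆ S := Ioo_subset_Icc_self.trans hIcc
  have hmM : m ≤ M := min_le_max
  have h₀ab : ξ₀ ∈ Ioo a b := ⟨by rw [ha]; linarith [min_le_left ξ₀ ξ₁], by rw [hb]; linarith [le_max_left ξ₀ ξ₁]⟩
  have h₁ab : ξ₁ ∈ Ioo a b := ⟨by rw [ha]; linarith [min_le_right ξ₀ ξ₁], by rw [hb]; linarith [le_max_right ξ₀ ξ₁]⟩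
  -- bound of `h` on `[a, b]`
  obtain ⟨C, hC⟩ := isCompact_Icc.exists_bound_of_continuousOn (hhc.mono hIcc)
  have hC0 : 0 ≤ C := (norm_nonneg _).trans (hC a (left_mem_Icc.mpr (by rw [ha, hb]; linarith)))
  -- Grönwall uniqueness against the zero solution
  have huniq := ODE_solution_unique_of_mem_Ioo (v := fun t x => h t * x) (s := fun _ => univ)
    (K := ⟨C, hC0⟩) (f := fun x => W x - Z x) (g := fun _ => 0) (a := a) (b := b) (t₀ := ξ₀)
    (fun t ht => by
      refine LipschitzOnWith.of_dist_le_mul fun x _ y _ => ?_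
      rw [Real.dist_eq, Real.dist_eq, ← mul_sub, abs_mul]
      have hCt := hC t (Ioo_subset_Icc_self ht)
      rw [Real.norm_eq_abs] at hCt
      exact mul_le_mul_of_nonneg_right (by exact_mod_cast hCt) (abs_nonneg _))
    h₀ab
    (fun t ht => ⟨hδ t (hIoo ht), mem_univ _⟩)
    (fun t ht => ⟨by simpa using hasDerivAt_const t (0 : ℝ), mem_univ _⟩)
    (by simp [heq])
  have := huniq h₁ab
  simp only at this
  linarith

/-- **The sign of `W − Z` is preserved** along every solution of (1.8) on an open interval on
which `D_W D_Z ≠ 0`: a solution with positive density at one point has positive density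
throughout ("It can not exit through the line `W = Z`").
[cite: BuckmasterCaolaboraGomezserrano2025, §1.3, proof of Prop. 3.1] -/
theorem sub_pos_of_exists {r : ℝ} {W Z W' Z' : ℝ → ℝ} {S : Set ℝ} (hS : IsOpen S)
    (hS' : S.OrdConnected)
    (hW : ∀ ξ ∈ S, HasDerivAt W (W' ξ) ξ) (hZ : ∀ ξ ∈ S, HasDerivAt Z (Z' ξ) ξ)
    (hDW : ∀ ξ ∈ S, DW (W ξ) (Z ξ) ≠ 0) (hDZ : ∀ ξ ∈ S, DZ (W ξ) (Z ξ) ≠ 0)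
    (hWeq : ∀ ξ ∈ S, DW (W ξ) (Z ξ) * W' ξ = NW r (W ξ) (Z ξ))
    (hZeq : ∀ ξ ∈ S, DZ (W ξ) (Z ξ) * Z' ξ = NZ r (W ξ) (Z ξ))
    {ξ₀ : ℝ} (h₀ : ξ₀ ∈ S) (hpos : Z ξ₀ < W ξ₀) :
    ∀ ξ ∈ S, Z ξ < W ξ := by
  intro ξ₁ h₁
  by_contra hlt
  have hle : W ξ₁ ≤ Z ξ₁ := not_lt.mp hlt
  -- `δ = W - Z` is continuous on `[[ξ₀, ξ₁]] ⊆ S`, positive at `ξ₀`, nonpositive at `ξ₁`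
  have hsub : uIcc ξ₀ ξ₁ ⊆ S := hS'.uIcc_subset h₀ h₁
  have hδc : ContinuousOn (fun x => W x - Z x) (uIcc ξ₀ ξ₁) := fun x hx =>
    ((hW x (hsub hx)).sub (hZ x (hsub hx))).continuousAt.continuousWithinAt
  have hIVT := intermediate_value_uIcc hδc
  have h0mem : (0 : ℝ) ∈ uIcc (W ξ₀ - Z ξ₀) (W ξ₁ - Z ξ₁) := by
    rw [mem_uIcc]
    right
    constructor <;> linarith
  obtain ⟨ξ₂, hξ₂, hξ₂0⟩ := hIVT h0mem
  have hall := sub_eq_zero_of_exists hS hS' hW hZ hDW hDZ hWeq hZeq (hsub hξ₂) (by linarith)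
  have := hall ξ₀ h₀
  linarith

end Monatomic

end BuckmasterCaolaboraGomezserrano2025

end Literature.Analysis.FluidPDE
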